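import Literature.Analysis.FluidPDE.ElgindiTransportIBP
import Literature.Analysis.FluidPDE.ElgindiTangentialRegularity
import Literature.Analysis.FluidPDE.ElgindiAveragingOperators
import HarnessLib

/-!
# Transposing the words `D_θ^i D_R^j ∂_θ^a` against test functions of the open strip
([Elgindi2021] §7.5, identification of weak limits of the weighted words)

Topic `Literature/Analysis/FluidPDE`. Support file (definitions with bodies and proved theorems, no
named facts) on the proof path of the named fact
`Literature.Analysis.FluidPDE.Elgindi.ElgindiGhoulMasmoudi2021_stabilityCore`
(`ElgindiStabilityDecomposition.lean`). T. M. Elgindi, Ann. of Math. 194 (2021) =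
arXiv:1904.04795, §7.5 (p. 24) and Remark 8.3 (p. 27): the passage from test functions to the
closure requires identifying `L²`-limits of the weighted words `D_θ^iD_R^j∂_θθΨ_n` with the words of
the limit, which is done distributionally.

The formal transposes on the open strip: `∂_θᵀφ = −∂_θφ`, `D_Rᵀφ = −(φ + R∂_Rφ)`,
`D_θᵀφ = −∂_θ(sin 2θ·φ)`; they preserve the test functions of the strip (`StripTest`), and for `u`
smooth on the open strip `∫∫_strip (D_θ^iD_R^j∂_θ^a u)·φ = ∫∫_strip u·(∂_θᵀ)^a(D_Rᵀ)^j(D_θᵀ)^i φ`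
(`integral_word_mul_test`).
-/

noncomputable section

open MeasureTheory Set Function Real Filter
open _root_.Topology
open scoped ENNReal ContDiff

namespace Literature.Analysis.FluidPDE

namespace Elgindi

/-! ### The transposed first-order operators -/

/-- `∂_θᵀφ = −∂_θφ`. [folklore] -/
def dθT (φ : ℝ → ℝ → ℝ) : ℝ → ℝ → ℝ := fun R θ => -dθ φ R θ

/-- `D_Rᵀφ = −(φ + R∂_Rφ)`. [folklore] -/
def DzT (φ : ℝ → ℝ → ℝ) : ℝ → ℝ → ℝ := fun R θ => -(φ R θ + dz φ R θ * R)

/-- `D_θᵀφ = −∂_θ(φ·sin 2θ)`. [folklore] -/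
def DθT (φ : ℝ → ℝ → ℝ) : ℝ → ℝ → ℝ := dθT fun R θ => φ R θ * Real.sin (2 * θ)

/-! ### Test functions are preserved -/

namespace StripTest

variable {f g : ℝ → ℝ → ℝ} (hf : StripTest f)
include hf

/-- Negation. [folklore] -/
theorem neg : StripTest fun R θ => -f R θ := by
  have e : (fun R θ => -f R θ) = fun z θ => f z θ * (fun _ : ℝ × ℝ => (-1:ℝ)) (z, θ) := by funext z θ; simp
  rw [e]; exact hf.mulOn contDiffOn_const

omit hf in
/-- Sum. [folklore] -/
theorem add (hf : StripTest f) (hg : StripTest g) : StripTest fun R θ => f R θ + g R θ := by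
  refine ⟨fun n => (hf.smooth n).add (hg.smooth n), hf.supp.add hg.supp, ?_⟩
  exact (tsupport_add (uncurry f) (uncurry g)).trans (union_subset hf.sub hg.sub)

/-- Multiplication by `sin 2θ`. [folklore] -/
theorem mul_sin2 : StripTest fun R θ => f R θ * Real.sin (2 * θ) :=
  hf.mulOn (φ := fun p : ℝ × ℝ => Real.sin (2 * p.2)) (by fun_prop)

/-- Multiplication by `R`. [folklore] -/
theorem mul_fst : StripTest fun R θ => f R θ * R :=
  hf.mulOn (φ := fun p : ℝ × ℝ => p.1) (by fun_prop)

/-- `∂_θᵀ` preserves test functions. [folklore] -/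
theorem ofdθT : StripTest (dθT f) := hf.ofdθ.neg

/-- `D_Rᵀ` preserves test functions. [folklore] -/
theorem ofDzT : StripTest (DzT f) := (hf.add hf.ofdz.mul_fst).neg

/-- `D_θᵀ` preserves test functions. [folklore] -/
theorem ofDθT : StripTest (DθT f) := hf.mul_sin2.ofdθT

/-- Iterates of `∂_θᵀ` preserve test functions. [folklore] -/
theorem iterate_dθT (a : ℕ) : StripTest (dθT^[a] f) := by
  induction a with
  | zero => exact hf
  | succ a ih => rw [Function.iterate_succ_apply']; exact ih.ofdθT

/-- Iterates of `D_Rᵀ` preserve test functions. [folklore] -/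
theorem iterate_DzT (j : ℕ) : StripTest (DzT^[j] f) := by
  induction j with
  | zero => exact hf
  | succ j ih => rw [Function.iterate_succ_apply']; exact ih.ofDzT

/-- Iterates of `D_θᵀ` preserve test functions. [folklore] -/
theorem iterate_DθT (i : ℕ) : StripTest (DθT^[i] f) := by
  induction i with
  | zero => exact hf
  | succ i ih => rw [Function.iterate_succ_apply']; exact ih.ofDθT

/-- The transposed word of a test function is a test function. [folklore] -/
theorem wordT (i j a : ℕ) : StripTest (dθT^[a] (DzT^[j] (DθT^[i] f))) := ((hf.iterate_DθT i).iterate_DzT j).iterate_dθT a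

/-- A test function is bounded. [folklore] -/
theorem exists_bound : ∃ M, ∀ p : ℝ × ℝ, |f p.1 p.2| ≤ M := by
  obtain ⟨M, hM⟩ := hf.supp.exists_bound_of_continuous (hf.smooth 0).continuous
  exact ⟨M, fun p => by have := hM p; rwa [Real.norm_eq_abs] at this⟩

/-- A test function is integrable on the strip. [folklore] -/
theorem integrableOn_strip : IntegrableOn (fun p : ℝ × ℝ => f p.1 p.2) strip volume := hf.integrable.integrableOn

end StripTest

/-! ### Smoothness of the first-order operators on the strip -/

/-- `D_R` preserves smoothness on the strip. [folklore] -/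
theorem contDiffOn_Dz_strip_infty {u : ℝ → ℝ → ℝ} (hu : ContDiffOn ℝ ∞ (uncurry u) strip) : ContDiffOn ℝ ∞ (uncurry (Dz u)) strip :=
  contDiffOn_infty.2 fun m => contDiffOn_iterate_Dz (j := 1) (contDiffOn_infty.1 hu (1 + m)) le_rfl

/-- `D_θ` preserves smoothness on the strip. [folklore] -/
theorem contDiffOn_Dθ_strip_infty {u : ℝ → ℝ → ℝ} (hu : ContDiffOn ℝ ∞ (uncurry u) strip) : ContDiffOn ℝ ∞ (uncurry (Dθ u)) strip :=
  contDiffOn_infty.2 fun m => contDiffOn_iterate_Dθ (i := 1) (contDiffOn_infty.1 hu (1 + m)) le_rfl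

/-- Iterates of `D_R` preserve smoothness on the strip. [folklore] -/
theorem contDiffOn_iterate_Dz_strip_infty {u : ℝ → ℝ → ℝ} (hu : ContDiffOn ℝ ∞ (uncurry u) strip) (j : ℕ) :
    ContDiffOn ℝ ∞ (uncurry (Dz^[j] u)) strip := by
  induction j with
  | zero => exact hu
  | succ j ih => rw [Function.iterate_succ_apply']; exact contDiffOn_Dz_strip_infty ih

/-- Iterates of `D_θ` preserve smoothness on the strip. [folklore] -/
theorem contDiffOn_iterate_Dθ_strip_infty {u : ℝ → ℝ → ℝ} (hu : ContDiffOn ℝ ∞ (uncurry u) strip) (i : ℕ) :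
    ContDiffOn ℝ ∞ (uncurry (Dθ^[i] u)) strip := by
  induction i with
  | zero => exact hu
  | succ i ih => rw [Function.iterate_succ_apply']; exact contDiffOn_Dθ_strip_infty ih

/-! ### Integration by parts against test functions -/

section ibp

variable {u φ : ℝ → ℝ → ℝ}

/-- `∫∫ (∂_θu)φ = ∫∫ u(∂_θᵀφ)`. [folklore] -/
theorem integral_dθ_mul_test (hu : ContDiffOn ℝ ∞ (uncurry u) strip) (hφ : StripTest φ) :
    ∫ p in strip, dθ u p.1 p.2 * φ p.1 p.2 = ∫ p in strip, u p.1 p.2 * dθT φ p.1 p.2 := by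
  have h := integral_strip_dθ_mul_test (g := uncurry u) hu hφ.smooth hφ.supp hφ.sub
  have e : (fun p : ℝ × ℝ => u p.1 p.2 * dθT φ p.1 p.2) = fun p => -(uncurry u p * dθ φ p.1 p.2) := by
    funext p; simp only [dθT]; rw [show uncurry u p = u p.1 p.2 from rfl]; ring
  rw [e, integral_neg]
  exact h

/-- `∫∫ (D_Ru)φ = ∫∫ u(D_Rᵀφ)`. [folklore] -/
theorem integral_Dz_mul_test (hu : ContDiffOn ℝ ∞ (uncurry u) strip) (hφ : StripTest φ) :
    ∫ p in strip, Dz u p.1 p.2 * φ p.1 p.2 = ∫ p in strip, u p.1 p.2 * DzT φ p.1 p.2 := by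
  have h := integral_strip_Dz_mul_test (g := uncurry u) hu hφ.smooth hφ.supp hφ.sub
  have e : (fun p : ℝ × ℝ => u p.1 p.2 * DzT φ p.1 p.2) = fun p => -(uncurry u p * (φ p.1 p.2 + p.1 * dz φ p.1 p.2)) := by
    funext p; simp only [DzT]; rw [show uncurry u p = u p.1 p.2 from rfl]; ring
  rw [e, integral_neg]
  exact h

/-- `∫∫ (D_θu)φ = ∫∫ u(D_θᵀφ)`. [folklore] -/
theorem integral_Dθ_mul_test (hu : ContDiffOn ℝ ∞ (uncurry u) strip) (hφ : StripTest φ) :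
    ∫ p in strip, Dθ u p.1 p.2 * φ p.1 p.2 = ∫ p in strip, u p.1 p.2 * DθT φ p.1 p.2 := by
  have e : (fun p : ℝ × ℝ => Dθ u p.1 p.2 * φ p.1 p.2) = fun p => dθ u p.1 p.2 * (φ p.1 p.2 * Real.sin (2 * p.2)) := by
    funext p; rw [Dθ_eq_mul_dθ]; ring
  rw [e]
  exact integral_dθ_mul_test hu hφ.mul_sin2

/-- `∫∫ (∂_θ^a u)φ = ∫∫ u((∂_θᵀ)^a φ)`. [folklore] -/
theorem integral_iterate_dθ_mul_test (hu : ContDiffOn ℝ ∞ (uncurry u) strip) (hφ : StripTest φ) (a : ℕ) :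
    ∫ p in strip, (dθ^[a] u) p.1 p.2 * φ p.1 p.2 = ∫ p in strip, u p.1 p.2 * (dθT^[a] φ) p.1 p.2 := by
  induction a generalizing u φ with
  | zero => rfl
  | succ a ih =>
    rw [Function.iterate_succ_apply, ih (contDiffOn_dθ_strip hu) hφ, integral_dθ_mul_test hu (hφ.iterate_dθT a),
      Function.iterate_succ_apply']

/-- `∫∫ (D_R^j u)φ = ∫∫ u((D_Rᵀ)^j φ)`. [folklore] -/
theorem integral_iterate_Dz_mul_test (hu : ContDiffOn ℝ ∞ (uncurry u) strip) (hφ : StripTest φ) (j : ℕ) :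
    ∫ p in strip, (Dz^[j] u) p.1 p.2 * φ p.1 p.2 = ∫ p in strip, u p.1 p.2 * (DzT^[j] φ) p.1 p.2 := by
  induction j generalizing u φ with
  | zero => rfl
  | succ j ih =>
    rw [Function.iterate_succ_apply, ih (contDiffOn_Dz_strip_infty hu) hφ, integral_Dz_mul_test hu (hφ.iterate_DzT j),
      Function.iterate_succ_apply']

/-- `∫∫ (D_θ^i u)φ = ∫∫ u((D_θᵀ)^i φ)`. [folklore] -/
theorem integral_iterate_Dθ_mul_test (hu : ContDiffOn ℝ ∞ (uncurry u) strip) (hφ : StripTest φ) (i : ℕ) :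
    ∫ p in strip, (Dθ^[i] u) p.1 p.2 * φ p.1 p.2 = ∫ p in strip, u p.1 p.2 * (DθT^[i] φ) p.1 p.2 := by
  induction i generalizing u φ with
  | zero => rfl
  | succ i ih =>
    rw [Function.iterate_succ_apply, ih (contDiffOn_Dθ_strip_infty hu) hφ, integral_Dθ_mul_test hu (hφ.iterate_DθT i),
      Function.iterate_succ_apply']

/-- **Transposing a word**: `∫∫_strip (D_θ^iD_R^j∂_θ^a u)·φ = ∫∫_strip u·(∂_θᵀ)^a(D_Rᵀ)^j(D_θᵀ)^i φ`
for `u` smooth on the open strip and a test function `φ` of the strip. [folklore] -/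
theorem integral_word_mul_test (hu : ContDiffOn ℝ ∞ (uncurry u) strip) (hφ : StripTest φ) (i j a : ℕ) :
    ∫ p in strip, (Dθ^[i] (Dz^[j] (dθ^[a] u))) p.1 p.2 * φ p.1 p.2 =
      ∫ p in strip, u p.1 p.2 * (dθT^[a] (DzT^[j] (DθT^[i] φ))) p.1 p.2 := by
  rw [integral_iterate_Dθ_mul_test (contDiffOn_iterate_Dz_strip_infty (contDiffOn_iterate_dθ_strip hu a) j) hφ i,
    integral_iterate_Dz_mul_test (contDiffOn_iterate_dθ_strip hu a) (hφ.iterate_DθT i) j,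
    integral_iterate_dθ_mul_test hu ((hφ.iterate_DθT i).iterate_DzT j) a]

end ibp

end Elgindi

end Literature.Analysis.FluidPDE
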